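import Summits.BirchSwinnertonDyer.Rank1Residual.GaloisImage.KolyvaginLevelOneUnitCaseOfFactsNoS24
import Summits.BirchSwinnertonDyer.Rank1Residual.GaloisImage.KolyvaginLevelOneUnitCaseTamagawa
import HarnessLib

/-!
# The EXOTIC unit case with `#Ш_an` a CONCLUSION, named facts `hPT`, `hEP` ONLY (NO [S24], NO GZK):
# `[0]⁺` a `3`-adic unit and `3 ∤ ∏ c_ℓ` give `BSD(E, 3)` and `ord₃ #Ш(E)_an = 0`
# (cell `b2b-bsdres`, team n1011, ROUTE-1 item R1-56 sub-item K6; row T-R1-56-K6, seat p09 GEN 6;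
# file 6 of the row; n1011-p13's `KolyvaginLevelOneUnitCaseTamagawa` (T-a5x-II (II.5)) re-run)

HONEST FRAMING (cell `b2b-bsdres`, run/shared/lean/b2b/bsd-rank1-residual/, verbatim in every
file): the goal of the cell is to DELETE the COMBINATION-SHAPED residual classes of the
Birch–Swinnerton-Dyer formula for ALL analytic-rank `≤ 1` elliptic curves over `ℚ` — "full BSD
formula for every rank `≤ 1` curve in class `C`" assembled STRICTLY from published theorems — so
that the rank-`≤ 1` remainder becomes exactly the CONSTRUCTION-SHAPED classes, which are TYPED
(missing-input `Prop`s), NOT attempted. This is not "finishing BSD". Team n1011 (N10/N11, the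
additive block `X4 ∧ p = 3`): research route; no claim beyond the stated classes; the label X4 and
the mark of RESIDUAL-MAP §I N11 are UNCHANGED by this file; nothing is booked. Theorems only: no
definition, no named fact is minted; CONDITIONAL on the named facts `hPT`, `hEP` and on THE PORT
DICT3₁ (a hypothesis — the located gap of row T-a5x, unchanged); NOTHING from [S24].

## What

* `bsdp_and_shaAn_unit_of_card_selmerGroup_three_eq_one` — the `[S24]`-FREE, GZK-FREE, PORT-FREE half
  of n1011-p13's `bsdp_three_and_shaAn_unit_of_dictionaryOne_of_tamagawa` (p278115), REFACTORED as a
  `3`-Selmer CERTIFICATE CONSUMER: for a globally minimal `W/ℚ` with `ρ̄_{E,3}` onto, `r_an = 0`,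
  `3 ∤ ∏ c_ℓ`, a modular parametrisation `P` (`L(E,1) = [0]⁺ · Ω⁺_f`), the `3`-adic unit period
  transfer and `[0]⁺` a `3`-adic unit, `#Sel^{(3)}(E/ℚ) = 1 ⟹ BSD(E, 3) ∧ ord₃ #Ш(E)_an = 0`.  Proof
  text = p13's, from "rank `0`, hence `Reg = 1`" on, VERBATIM (`#Ш_an = [0]⁺·#tors²/(u·∏c)`; ord₃ = 0
  by `ratModP 3 [0]⁺ ≠ 0`, `|u|₃ = 1`, `E(ℚ)[3] = 0` from surj(3), `3 ∤ ∏c`); any producer of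
  `#Sel^{(3)} = 1` may now call it.
* `bsdp_three_and_shaAn_unit_of_dictionaryOne_of_tamagawa_noS24` — p13's theorem with `hS24`, `hS24₂`
  DELETED: DICT3₁ → Kato classes → certificate → `#Sel^{(3)} = 1` (file 4's
  `natCard_selmerGroup_three_eq_one_of_levelOne_certificate_noS24`, Mazur–Rubin Thm. 4.3.4 at `m = 1`,
  p284602) → the consumer above.
* `exists_kolyvaginDatum_bsdp_three_of_dictionaryOne_of_tamagawa_noS24` — the `∃ S τ η D v₃` form.

EXOTIC rows stay REDUCED (to DICT3₁ + `hPT` + `hEP`), none closed; nothing booked; no mark / label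
changed.

References: [Rubin2011] Thm. 2.8.4 (p. 25); [MazurRubin2004] Thm. 4.3.4 (p. 45); [Kim2022StructureSelmer]
Thm. 3.13; [MazurTateTeitelbaum1986Invent] §I.8 (8.6); [Miller2011LMS] §1, Def. 1.1.
-/

noncomputable section

open scoped Classical NumberField ContRepresentation
open Field NumberField IsDedekindDomain
open WeierstrassCurve Literature.NumberTheory.EllipticCurves Literature.NumberTheory.EllipticCurves.ModularForms
  Literature.NumberTheory.EllipticCurves.Rank1Residual
  Literature.NumberTheory.EllipticCurves.Rank1Residual.Typed
  Literature.NumberTheory.GaloisRepresentations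
  Literature.NumberTheory.GaloisRepresentations.DiscreteGaloisModule Literature.NumberTheory.GaloisCohomology
open Literature.NumberTheory.DiophantineGeometry.Dioph (ratModP)

namespace Summit.BirchSwinnertonDyer.Rank1Residual.GaloisImage

variable (W : WeierstrassCurve ℚ) [W.IsElliptic]

/-- **The `3`-Selmer certificate consumer with `#Ш_an` a CONCLUSION (GZK-free, [S24]-free,
port-free).**  For a globally minimal `W/ℚ` with `ρ̄_{E,3}` onto (so `E(ℚ)[3] = 0`), analytic rank
`0`, `3 ∤ ∏ c_ℓ`, a modular parametrisation `P` (`L(E, 1) = [0]⁺ · Ω⁺_f`,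
`IsNewformOf.entireLFunction_one_eq`), the `3`-adic unit period transfer `Ω = u · Ω⁺_f` and `[0]⁺` a
`3`-adic unit: **`#Sel^{(3)}(E/ℚ) = 1 ⟹ BSD(E, 3) ∧ ∃ q, #Ш(E)_an = q ∧ ord₃ q = 0`.**  Rank `0`
from the certificate (`mordellWeilRank_eq_zero_of_card_selmerGroup_eq_one`), `Reg = 1`,
`#Ш_an = [0]⁺ · #tors² / (u · ∏c) ∈ ℚ` with `ord₃ = 0`, then p13's GZK-free consumer
`bsdp_of_card_selmerGroup_eq_one_of_analyticRank_eq_zero`.  Proof text = n1011-p13's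
`bsdp_three_and_shaAn_unit_of_dictionaryOne_of_tamagawa` (T-a5x-II (II.5)) from "rank `0`" on,
VERBATIM — refactored here so that the [S24]-free chain (and any other `#Sel^{(3)} = 1` producer) can
call it.  Nothing booked; not a class theorem. [cite: MazurTateTeitelbaum1986Invent, §I.8 (8.6)]
[cite: Miller2011LMS, §1 and Def. 1.1] [cite: SilvermanAEC2009, Thm X.4.2(a)] -/
theorem bsdp_and_shaAn_unit_of_card_selmerGroup_three_eq_one [W.IsGloballyMinimal]
    (h3 : W.HasSurjectiveModNGaloisRep ((3 : ℕ) : ℤ)) (hr : W.analyticRank = 0)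
    (htam : ¬ 3 ∣ W.tamagawaProduct)
    {N : ℕ} [NeZero N] (P : ModularParametrizationData W N)
    (hΩ : ∃ u : ℚ, ‖(u : ℚ_[3])‖ = 1 ∧ W.realPeriodRat = u * plusPeriod P.f)
    (hunit : ratModP 3 (ratPlusSymbol P.f 0) ≠ 0)
    (hsel : Nat.card (W.selmerGroup (3 : ℤ)) = 1) :
    BSDp W 3 ∧ ∃ q : ℚ, shaAn W = (q : ℂ) ∧ padicValRat 3 q = 0 := by
  haveI : Fact (Nat.Prime 3) := ⟨Nat.prime_three⟩
  -- rank `0`, hence `Reg = 1`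
  have hr0 : W.mordellWeilRank = 0 :=
    mordellWeilRank_eq_zero_of_card_selmerGroup_eq_one W 3 (by exact_mod_cast hsel)
  have hReg : W.regulator = 1 := W.regulator_eq_one_of_rank_zero hr0
  -- `#Ш_an = [0]⁺ · #tors² / (u · ∏c)`
  obtain ⟨u, hu, hΩu⟩ := hΩ
  have hu0 : u ≠ 0 := by
    rintro rfl
    rw [Rat.cast_zero, norm_zero] at hu
    exact zero_ne_one hu
  have hΩf : 0 < plusPeriod P.f :=
    IsNewform0.plusPeriod_pos_holds P.isNewformOf.1 P.isNewformOf.coeffField_eq_bot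
  have hT : 0 < W.torsionOrder := W.torsionOrder_pos_holds
  have hc : 0 < W.tamagawaProduct := W.tamagawaProduct_pos'
  set q : ℚ := ratPlusSymbol P.f 0 * (W.torsionOrder : ℚ) ^ 2 / (u * (W.tamagawaProduct : ℚ)) with hqdef
  have hsha : shaAn W = ((q : ℚ) : ℂ) := by
    rw [shaAn_def, W.leadingLCoeff_eq_of_analyticRank_eq_zero hr, P.isNewformOf.entireLFunction_one_eq,
      hReg, hΩu, hqdef]
    have hcC : ((W.tamagawaProduct : ℚ) : ℂ) ≠ 0 := by exact_mod_cast hc.ne'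
    have huC : ((u : ℚ) : ℂ) ≠ 0 := by exact_mod_cast hu0
    have hΩfC : ((plusPeriod P.f : ℝ) : ℂ) ≠ 0 := by exact_mod_cast hΩf.ne'
    push_cast
    field_simp
  have hvq : padicValRat 3 q = 0 := by
    have h0 : padicValRat 3 (ratPlusSymbol P.f 0) = 0 := padicValRat_eq_zero_of_ratModP_ne_zero hunit
    have hsym0 : ratPlusSymbol P.f 0 ≠ 0 := by
      intro h
      apply hunit
      rw [h, Literature.NumberTheory.DiophantineGeometry.Dioph.ratModP]
      simp
    have huval : padicValRat 3 u = 0 := padicValRat_eq_zero_of_norm_ratCast_eq_one hu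
    have hT0 : (W.torsionOrder : ℚ) ≠ 0 := by exact_mod_cast hT.ne'
    have hc0 : (W.tamagawaProduct : ℚ) ≠ 0 := by exact_mod_cast hc.ne'
    have hirr : W.HasIrreducibleModPGaloisRep 3 :=
      hasIrreducibleModPGaloisRep_of_hasSurjectiveModNGaloisRep W 3 h3
    have htors : padicValNat 3 W.torsionOrder = 0 := padicValNat_torsionOrder_eq_zero_of_irreducible W 3 hirr
    have htamv : padicValNat 3 W.tamagawaProduct = 0 := padicValNat.eq_zero_of_not_dvd htam
    rw [hqdef, padicValRat.div (mul_ne_zero hsym0 (pow_ne_zero 2 hT0)) (mul_ne_zero hu0 hc0),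
      padicValRat.mul hsym0 (pow_ne_zero 2 hT0), padicValRat.pow, padicValRat.mul hu0 hc0, h0, huval,
      padicValRat.of_nat, padicValRat.of_nat, htors, htamv]
    simp
  exact ⟨bsdp_of_card_selmerGroup_eq_one_of_analyticRank_eq_zero W 3 hr hsha hvq (by exact_mod_cast hsel),
    q, hsha, hvq⟩

/-- **The EXOTIC unit case with `#Ш_an` a CONCLUSION, WITHOUT the [S24] facts.**  n1011-p13's
`bsdp_three_and_shaAn_unit_of_dictionaryOne_of_tamagawa` (p278115) with `hS24`, `hS24₂` DELETED: on an
additive `3 ∤ c₃`, surj(3), `E(ℚ₃)[3] = 0`, `r_an = 0`, `3 ∤ ∏ c_ℓ` row (globally minimal `W`, modular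
parametrisation `P` with `3 ∤ c_P`, unit period transfer, `[0]⁺` a `3`-adic unit), THE PORT DICT3₁ and
the named facts `hPT`, `hEP` give `BSD(E, 3) ∧ ord₃ #Ш(E)_an = 0`.  Chain: DICT3₁ → Kato classes →
certificate (p13's `apply_empty_not_mem_selmerGroup_kummer_of_dictionary`) → `#Sel^{(3)} = 1` (file 4's
`natCard_selmerGroup_three_eq_one_of_levelOne_certificate_noS24` — Mazur–Rubin Thm. 4.3.4 at `m = 1`,
p284602, NO Kolyvagin-system structure theorem) → `bsdp_and_shaAn_unit_of_card_selmerGroup_three_eq_one`.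
Every hypothesis is an a-priori invariant of the row; nothing presupposes the rank or `#Ш_an`.  NO
tower, NO (im), NO GZK, NO [S24].  EXOTIC rows REDUCED (to DICT3₁ + `hPT`, `hEP`), none closed; nothing
booked; no mark / label changed. [cite: Kim2022StructureSelmer, Thm. 3.13]
[cite: Rubin2011, Thm. 2.8.4 (p. 25)] [cite: MazurTateTeitelbaum1986Invent, §I.8 (8.6)]
[cite: Miller2011LMS, §1 and Def. 1.1] -/
theorem bsdp_three_and_shaAn_unit_of_dictionaryOne_of_tamagawa_noS24 [W.IsGloballyMinimal]
    (hPT : poitouTate_selmerStructure_duality ℚ)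
    (hEP : ∀ v : HeightOneSpectrum (𝓞 ℚ), localEulerPoincareCharacteristic (v.adicCompletion ℚ))
    [Finite (geomTorsion W ((3 : ℕ) : ℤ))]
    (hX : Addv W 3) (hc3 : ¬ 3 ∣ (W.baseChange ℚ_[3]).localTamagawaNumber ℤ_[3])
    (h3 : W.HasSurjectiveModNGaloisRep ((3 : ℕ) : ℤ)) (hr : W.analyticRank = 0)
    (ht : Nat.card {Q : (W.baseChange ℚ_[3]).toAffine.Point // (3 : ℕ) • Q = 0} = 1)
    (htam : ¬ 3 ∣ W.tamagawaProduct)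
    (τ : absoluteGaloisGroup ℚ) (hτμ : τ ∈ rootsOfUnityFixer ℚ 3)
    (hτq : Nonempty (cokerSubOne (W.torsionGaloisModule ((3 : ℕ) : ℤ)) τ ≃+ ZMod 3))
    (S : Finset (Place ℚ)) (hS : ∀ w : InfinitePlace ℚ, (Sum.inl w : Place ℚ) ∈ S)
    (h3S : ∀ v : HeightOneSpectrum (𝓞 ℚ), ((3 : ℕ) : 𝓞 ℚ) ∈ v.asIdeal → (Sum.inr v : Place ℚ) ∈ S)
    (hbadS : ∀ v : HeightOneSpectrum (𝓞 ℚ), ¬ W.HasGoodReductionAt v → (Sum.inr v : Place ℚ) ∈ S)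
    (D : KolyvaginDatum (W.torsionGaloisModule ((3 : ℕ) : ℤ)))
    (η : (q : HeightOneSpectrum (𝓞 ℚ)) → (ZMod (Ideal.absNorm q.asIdeal))ˣ)
    (hP : D.primes = frobeniusClassPrimes (W.torsionGaloisModule ((3 : ℕ) : ℤ))
      {v | (Sum.inr v : Place ℚ) ∈ S} τ 3)
    (hT : D.transverse = cyclotomicTransverse (W.torsionGaloisModule ((3 : ℕ) : ℤ)))
    (hD : D.HasCanonicalComparison 3 η)
    (v₃ : HeightOneSpectrum (𝓞 ℚ)) (hv₃ : ((3 : ℕ) : 𝓞 ℚ) ∈ v₃.asIdeal)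
    (hDict : KatoKuriharaDictionaryThreeOneAt W 0 D v₃)
    {N : ℕ} [NeZero N] (P : ModularParametrizationData W N)
    (hManin : ¬ ((3 : ℕ) : ℤ) ∣ P.maninConstant)
    (hΩ : ∃ u : ℚ, ‖(u : ℚ_[3])‖ = 1 ∧ W.realPeriodRat = u * plusPeriod P.f)
    (hunit : ratModP 3 (ratPlusSymbol P.f 0) ≠ 0) :
    BSDp W 3 ∧ ∃ q : ℚ, shaAn W = (q : ℂ) ∧ padicValRat 3 q = 0 := by
  haveI : Fact (Nat.Prime 3) := ⟨Nat.prime_three⟩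
  -- the Poitou–Tate family, the Kato classes, the certificate, `#Sel^(3) = 1` (NO [S24])
  obtain ⟨inv, hperf, hsum, -, hcompl⟩ := hPT 3
  obtain ⟨κ₀, Λ, -, ⟨κ', hI4⟩, -, hΛker, hdict⟩ :=
    hDict hX hc3 h3 (by rw [ht, pow_zero]) hv₃ P hManin hΩ
  obtain ⟨w, ψ, -, hval⟩ := hdict ∅ D.isLevel_empty
  rw [kuriharaNumber_eq_ratModP_of_eq_one P.f 3 _ _ Finset.prod_empty ψ] at hval
  have hcert := apply_empty_not_mem_selmerGroup_kummer_of_dictionary W v₃ κ₀ κ' hI4 Λ hΛker hval rfl hunit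
  have hsel : Nat.card (W.selmerGroup (3 : ℤ)) = 1 :=
    natCard_selmerGroup_three_eq_one_of_levelOne_certificate_noS24 W h3 τ hτμ hτq inv hperf hsum hcompl
      hEP S hS h3S hbadS D η hP hT hD κ' hcert
  exact bsdp_and_shaAn_unit_of_card_selmerGroup_three_eq_one W h3 hr htam P hΩ hunit hsel

/-- **The same with `S`, `τ`, `η`, `D`, `v₃` discharged existentially, WITHOUT the [S24] facts** —
n1011-p13's `exists_kolyvaginDatum_bsdp_three_of_dictionaryOne_of_tamagawa` with `hS24`, `hS24₂`
DELETED: on an additive `3 ∤ c₃`, surj(3), `E(ℚ₃)[3] = 0`, `r_an = 0`, `3 ∤ ∏ c_ℓ` row of a globally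
minimal `W/ℚ` with a modular parametrisation `P`, `3 ∤ c_P`, the unit period transfer and `[0]⁺` a
`3`-adic unit, granted `hPT`, `hEP`, there are `S, τ, η, D, v₃` such that DICT3₁ implies `BSD(E, 3)`
and `ord₃ #Ш(E)_an = 0`.  Nothing booked; EXOTIC rows REDUCED, none closed.
[cite: Kim2022StructureSelmer, Thm. 3.13] [cite: Rubin2011, Thm. 2.8.4 (p. 25)]
[cite: Miller2011LMS, §1 and Def. 1.1] -/
theorem exists_kolyvaginDatum_bsdp_three_of_dictionaryOne_of_tamagawa_noS24 [W.IsGloballyMinimal]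
    (hPT : poitouTate_selmerStructure_duality ℚ)
    (hEP : ∀ v : HeightOneSpectrum (𝓞 ℚ), localEulerPoincareCharacteristic (v.adicCompletion ℚ))
    [Finite (geomTorsion W ((3 : ℕ) : ℤ))]
    (hX : Addv W 3) (hc3 : ¬ 3 ∣ (W.baseChange ℚ_[3]).localTamagawaNumber ℤ_[3])
    (h3 : W.HasSurjectiveModNGaloisRep ((3 : ℕ) : ℤ)) (hr : W.analyticRank = 0)
    (ht : Nat.card {Q : (W.baseChange ℚ_[3]).toAffine.Point // (3 : ℕ) • Q = 0} = 1)
    (htam : ¬ 3 ∣ W.tamagawaProduct)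
    {N : ℕ} [NeZero N] (P : ModularParametrizationData W N)
    (hManin : ¬ ((3 : ℕ) : ℤ) ∣ P.maninConstant)
    (hΩ : ∃ u : ℚ, ‖(u : ℚ_[3])‖ = 1 ∧ W.realPeriodRat = u * plusPeriod P.f)
    (hunit : ratModP 3 (ratPlusSymbol P.f 0) ≠ 0) :
    ∃ (S : Finset (Place ℚ)) (τ : absoluteGaloisGroup ℚ)
      (η : (q : HeightOneSpectrum (𝓞 ℚ)) → (ZMod (Ideal.absNorm q.asIdeal))ˣ)
      (D : KolyvaginDatum (W.torsionGaloisModule ((3 : ℕ) : ℤ))) (v₃ : HeightOneSpectrum (𝓞 ℚ)),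
      (∀ w : InfinitePlace ℚ, (Sum.inl w : Place ℚ) ∈ S) ∧
      (∀ v : HeightOneSpectrum (𝓞 ℚ), ((3 : ℕ) : 𝓞 ℚ) ∈ v.asIdeal → (Sum.inr v : Place ℚ) ∈ S) ∧
      (∀ v : HeightOneSpectrum (𝓞 ℚ), ¬ W.HasGoodReductionAt v → (Sum.inr v : Place ℚ) ∈ S) ∧
      τ ∈ rootsOfUnityFixer ℚ 3 ∧
      Nonempty (cokerSubOne (W.torsionGaloisModule ((3 : ℕ) : ℤ)) τ ≃+ ZMod 3) ∧
      D.primes = frobeniusClassPrimes (W.torsionGaloisModule ((3 : ℕ) : ℤ))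
        {v | (Sum.inr v : Place ℚ) ∈ S} τ 3 ∧
      D.transverse = cyclotomicTransverse (W.torsionGaloisModule ((3 : ℕ) : ℤ)) ∧
      D.HasCanonicalComparison 3 η ∧ ((3 : ℕ) : 𝓞 ℚ) ∈ v₃.asIdeal ∧
      (KatoKuriharaDictionaryThreeOneAt W 0 D v₃ →
        BSDp W 3 ∧ ∃ q : ℚ, shaAn W = (q : ℂ) ∧ padicValRat 3 q = 0) := by
  haveI : Fact (Nat.Prime 3) := ⟨Nat.prime_three⟩
  obtain ⟨S, -, hS, h3S, hbadS⟩ := X11b.KummerPT.exists_exceptional_finset W 3 (∅ : Finset (Place ℚ))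
  obtain ⟨τ, hτ, hτq⟩ := exists_rootsOfUnityFixer_cokerSubOne_equiv_zmod_three_of_surj W h3
  have hτμ : τ ∈ rootsOfUnityFixer ℚ 3 := hτ 3 (by norm_num)
  obtain ⟨η, D, hP, hT, hD⟩ :=
    FSComp.exists_eta_kolyvaginDatum_hasCanonicalComparison_frobeniusClassPrimes
      (W.torsionGaloisModule ((3 : ℕ) : ℤ)) 3 {v | (Sum.inr v : Place ℚ) ∈ S} hτμ hτq
      (cyclotomicTransverse (W.torsionGaloisModule ((3 : ℕ) : ℤ)))
  let v₃ : HeightOneSpectrum (𝓞 ℚ) := (Rat.HeightOneSpectrum.primesEquiv (R := 𝓞 ℚ)).symm ⟨3, Nat.prime_three⟩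
  have hv₃ : ((3 : ℕ) : 𝓞 ℚ) ∈ v₃.asIdeal := three_mem_primesEquiv_symm_three
  exact ⟨S, τ, η, D, v₃, hS, h3S, hbadS, hτμ, hτq, hP, hT, hD, hv₃, fun hDict =>
    bsdp_three_and_shaAn_unit_of_dictionaryOne_of_tamagawa_noS24 W hPT hEP hX hc3 h3 hr ht htam τ hτμ
      hτq S hS h3S hbadS D η hP hT hD v₃ hv₃ hDict P hManin hΩ hunit⟩

end Summit.BirchSwinnertonDyer.Rank1Residual.GaloisImage

end
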